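import Literature.AlgebraicGeometry.Resolution.LipmanValuativeQuadraticSequenceProofs
import Literature.AlgebraicGeometry.Resolution.ArithmeticalThreefoldsMonomials
import Literature.AlgebraicGeometry.Resolution.RsopMonomialIdeals
import Literature.AlgebraicGeometry.Resolution.AlterationsEnlargingZ
import HarnessLib

/-!
# Read-off of the residue-side chain format from a monomial form in a regular local ring embedded in the residue field

Route `RadicialJung`, crux `CleanModels` (stmt-ResolutionOfSingularities-15917), registered skeleton `Cruxes/CleanModels/Lines/Sketch.lean`
rev 35 (sha16 de44649d8f729c3b), stub 7 `stub_cleanModelsDimGEFour`.  Explicit-unit seat `decomp-res-hand-2` g6 (structural hand): the last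
brick of the residue-side DRIVER `CossartJannsenSaito2020Embedded → ResidueChains` (spec `Lines/Sketch_hand2_g5_NS32_assembly_spec.lean` rev 4).
OURS; structural bookkeeping, counted 0; nothing here proves resolution of singularities in characteristic `p`.

`readOff_of_monomial_form` — RING-LEVEL read-off: let `R` be a regular local ring with a regular system of parameters `(x₁..x_r; y₁..y_e)`,
`ψ : R ↪ F` an embedding into a field with image a subring `Sq ⊆ Ō` dominated by the valuation ring `Ō` (`locAtCentre Sq Ō = Sq`), and
`g = u · ∏ xᵢ^{αᵢ}` in `R` with `u` a unit.  Then, with `xb := ψ ∘ (x, y)`: the `xb i` lie in `Sq`, are non-zero of positive `ν̄`-value and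
generate the centre of `ν̄` on `Sq`; `Sq` is regular of dimension `r + e`; and every DIVISOR `d ∈ Sq` of `ψ g` inside `Sq` is a `ν̄`-unit of
`Sq` times a monomial in the `xb` (divisors of a unit times a monomial in prime elements, ✓ `exists_eq_units_mul_prod_pow_of_dvd`).  This is
the tail format `∃ t xb, …` of the hypothesis `hChains` of ✓ `localMonomialization_four_of_rankOne_of_residueChains`.
[cite: CossartPiltant2008, Prop. 4.1] [cite: NovacoskiSpivakovsky2014, §3.2]
-/

noncomputable section

set_option linter.dupNamespace false -- mandated namespace of this single-conjunct summit

open IsLocalRing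
open Literature.AlgebraicGeometry.Resolution

namespace Summit.ResolutionOfSingularities.ResolutionOfSingularities.Theorems.RadicialJung.CleanModels

universe u v

/-- A full regular system of parameters `(x; y)` of a regular local ring, appended, is (trivially) part of a regular system of parameters.
[folklore] -/
theorem isRsopPart_append_of_span_eq {R : Type u} [CommRing R] [IsRegularLocalRing R] {r e : ℕ}
    (xs : Fin r → R) (ys : Fin e → R) (hdim : ringKrullDim R = (r + e : ℕ))
    (hspan : Ideal.span (Set.range xs ∪ Set.range ys) = maximalIdeal R) :
    IsRsopPart (Fin.append xs ys) := by
  refine ⟨inferInstance, 0, Fin.elim0, by rw [hdim, Nat.add_zero], ?_⟩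
  rw [range_fin_append, Set.range_eq_empty Fin.elim0, Set.union_empty, hspan]

/-- **Read-off of the residue-side chain format from a monomial form.**  See the module docstring.
[cite: CossartPiltant2008, Prop. 4.1] [cite: NovacoskiSpivakovsky2014, §3.2] -/
theorem readOff_of_monomial_form {F : Type v} [Field F] (Ō : ValuationSubring F)
    {R : Type u} [CommRing R] [IsRegularLocalRing R]
    (ψ : R →+* F) (hψ : Function.Injective ψ) (Sq : Subring F) (hrange : ψ.range = Sq)
    (hSqŌ : Sq ≤ Ō.toSubring) (hdomSq : locAtCentre Sq Ō = Sq)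
    {r e : ℕ} (xs : Fin r → R) (ys : Fin e → R) (hdim : ringKrullDim R = (r + e : ℕ))
    (hspan : Ideal.span (Set.range xs ∪ Set.range ys) = maximalIdeal R)
    (g u : R) (α : Fin r → ℕ) (hu : IsUnit u) (hg : g = u * ∏ i, xs i ^ α i) :
    ∃ (t : ℕ) (xb : Fin t → F), (∀ i, xb i ∈ Sq) ∧ (∀ i, Ō.valuation (xb i) < 1) ∧ (∀ i, xb i ≠ 0) ∧
      (∀ f ∈ Sq, Ō.valuation f < 1 → ∃ c : Fin t → F, (∀ i, c i ∈ Sq) ∧ f = ∑ i, c i * xb i) ∧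
      IsRegularLocalRing Sq ∧ ringKrullDim Sq = (t : WithBot ℕ∞) ∧
      (∀ d ∈ Sq, (∃ c ∈ Sq, ψ g = d * c) →
        ∃ (ub : F) (δ : Fin t → ℕ), ub ∈ Sq ∧ Ō.valuation ub = 1 ∧ d = ub * ∏ i, xb i ^ δ i) := by
  classical
  haveI : IsDomain R := isDomain_of_isRegularLocalRing R
  haveI : IsLocalRing Sq := isLocalRing_of_range_eq ψ Sq hrange
  have hrange' : ψ.range = locAtCentre Sq Ō := hrange.trans hdomSq.symm
  have hdomR : ∀ a, a ∈ maximalIdeal R ↔ Ō.valuation (ψ a) < 1 :=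
    mem_maximalIdeal_iff_of_range_eq_locAtCentre Ō ψ hψ hSqŌ hrange'
  have hmemSq : ∀ a, ψ a ∈ Sq := fun a => hrange ▸ ⟨a, rfl⟩
  -- the full regular system of parameters
  let z : Fin (r + e) → R := Fin.append xs ys
  have hz : IsRsopPart z := isRsopPart_append_of_span_eq xs ys hdim hspan
  have hspanz : Ideal.span (Set.range z) = maximalIdeal R := by
    change Ideal.span (Set.range (Fin.append xs ys)) = _
    rw [range_fin_append, hspan]
  -- the ring isomorphism `R ≃ Sq`
  let eψ : R ≃+* Sq :=
    (RingEquiv.ofBijective ψ.rangeRestrict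
      ⟨fun a b hab => hψ (congrArg Subtype.val hab), ψ.rangeRestrict_surjective⟩).trans (RingEquiv.subringCongr hrange)
  -- `g` as a unit times a monomial in the full system
  let α' : Fin (r + e) → ℕ := Fin.append α 0
  have hg' : g = u * ∏ i, z i ^ α' i := by
    rw [hg, Fin.prod_univ_add]
    congr 1
    have h1 : ∏ i : Fin r, z (Fin.castAdd e i) ^ α' (Fin.castAdd e i) = ∏ i, xs i ^ α i :=
      Finset.prod_congr rfl fun i _ => by
        simp only [z, α', Fin.append_left]
    have h2 : ∏ j : Fin e, z (Fin.natAdd r j) ^ α' (Fin.natAdd r j) = 1 :=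
      Finset.prod_eq_one fun j _ => by
        simp only [α', Fin.append_right, Pi.zero_apply, pow_zero]
    rw [h1, h2, mul_one]
  refine ⟨r + e, fun i => ψ (z i), fun i => hmemSq _, fun i => (hdomR _).mp (hz.mem_maximalIdeal i),
    fun i h0 => hz.ne_zero i (hψ ((map_zero ψ).symm ▸ h0)), ?_, ?_, ?_, ?_⟩
  · -- generation of the centre
    intro f hf hvf
    obtain ⟨a, rfl⟩ : f ∈ ψ.range := hrange ▸ hf
    have ha : a ∈ Ideal.span (Set.range z) := hspanz ▸ (hdomR a).mpr hvf
    obtain ⟨c, hc⟩ := Ideal.mem_span_range_iff_exists_fun.mp ha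
    refine ⟨fun i => ψ (c i), fun i => hmemSq _, ?_⟩
    rw [← hc, map_sum]
    simp_rw [map_mul]
  · exact IsRegularLocalRing.of_ringEquiv eψ
  · rw [← ringKrullDim_eq_of_ringEquiv eψ, hdim]
  · -- divisors of `ψ g` inside `Sq`
    rintro d hd ⟨c, hc, hdc⟩
    obtain ⟨a, rfl⟩ : d ∈ ψ.range := hrange ▸ hd
    obtain ⟨b, rfl⟩ : c ∈ ψ.range := hrange ▸ hc
    have hab : g = a * b := hψ (by rw [map_mul, hdc])
    have hdvd : a ∣ ∏ i, z i ^ α' i := by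
      have h1 : a ∣ u * ∏ i, z i ^ α' i := ⟨b, by rw [← hg', hab]⟩
      exact (hu.dvd_mul_left).mp h1
    obtain ⟨cU, δ, ha⟩ := CossartPiltantMonomial.exists_eq_units_mul_prod_pow_of_dvd (fun i => hz.prime i) α' hdvd
    refine ⟨ψ (cU : R), δ, hmemSq _, ?_, ?_⟩
    · -- a unit has value `1`
      have hnot : ¬ Ō.valuation (ψ (cU : R)) < 1 := fun hlt =>
        (IsLocalRing.mem_maximalIdeal _).mp ((hdomR _).mpr hlt) cU.isUnit
      exact le_antisymm ((Ō.valuation_le_one_iff _).mpr (hSqŌ (hmemSq _))) (not_lt.mp hnot)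
    · rw [ha, map_mul, map_prod]
      simp_rw [map_pow]

end Summit.ResolutionOfSingularities.ResolutionOfSingularities.Theorems.RadicialJung.CleanModels

end
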